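import Mathlib
import Literature.NumberTheory.LFunctions.WeilMarkovQuadratic
import Literature.NumberTheory.LFunctions.WeilDilationVirial
import HarnessLib

/-!
# `EvenWinsArch` — stub T2: the dilation identity for the archimedean energy

For a Weil test function `g` supported in `[-R, R]` and a compression factor `c > 0`,
substituting `u = c t` in the prime-free archimedean energy of the compressed increments and
using `D_u(g) = 2‖g‖₂²` for `u > 2R` (the translate `g(· + u)` and `g` have disjoint supports):

`∫₀^∞ w(t) D_{ct}(g) dt = ∫_{(0,2R]} (w(u/c)/c) D_u(g) du + 2‖g‖₂² ∫_{2R/c}^∞ w(t) dt`,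

`w = weilArchDensity`, `D = weilIncrement`; the finite-part integrand is integrable on `(0, 2R]`.

Route `WeilParity`, crux `EvenWinsArch` (stmt-RiemannHypothesis-15433), line `birth`,
stub `stub_dilationEnergy`.
-/

set_option linter.dupNamespace false

noncomputable section

namespace Summit.RiemannHypothesis.RiemannHypothesis.Theorems.WeilParity.EvenWinsArch

open Set MeasureTheory Filter
open Literature.NumberTheory.LFunctions

/-- For `g ∈ L²` vanishing off `[-R, R]` and a shift `u ≥ 2R` the translate `g(· + u)` and `g`
have (a.e.) disjoint supports, so `D_u(g) = 2‖g‖₂²`. [folklore] -/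
theorem dilationEnergy_weilIncrement_eq_two_mul {R : ℝ} {g : ℝ → ℂ} (hg : MemLp g 2)
    (hgs : ∀ x, x ∉ Icc (-R) R → g x = 0) {u : ℝ} (hu : 2 * R ≤ u) :
    weilIncrement g u = 2 * ∫ x, ‖g x‖ ^ 2 := by
  -- adapted from `WeilWindowFlowWindowLipschitzStubFormDomainPos` (private `weilIncrement_eq_two_mul`)
  have h2 : Integrable fun x : ℝ ↦ ‖g x‖ ^ 2 := (memLp_two_iff_integrable_sq_norm hg.1).1 hg
  have h2' : Integrable fun x : ℝ ↦ ‖g (x + u)‖ ^ 2 := h2.comp_add_right u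
  have hae : (fun x : ℝ ↦ ‖g (x + u) - g x‖ ^ 2) =ᵐ[volume]
      fun x ↦ ‖g (x + u)‖ ^ 2 + ‖g x‖ ^ 2 := by
    filter_upwards [Measure.ae_ne volume (-R)] with x hx
    rcases lt_or_gt_of_ne hx with hlt | hgt
    · have h0 : g x = 0 := hgs x fun hm ↦ by linarith [hm.1]
      simp [h0]
    · have h0 : g (x + u) = 0 := hgs (x + u) fun hm ↦ by linarith [hm.2]
      simp [h0]
  rw [weilIncrement, integral_congr_ae hae, integral_add h2' h2,
    integral_add_right_eq_self (fun x : ℝ ↦ ‖g x‖ ^ 2) u]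
  ring

/-- **Scale covariance of the increments**: `D_{ct}(g) = c · D_t(g(c ·))` for `c > 0`
(substitute `x = c y` in `∫ |g(x + ct) − g(x)|² dx`). [folklore] -/
theorem dilationEnergy_weilIncrement_mul_left (g : ℝ → ℂ) {c : ℝ} (hc : 0 < c) (t : ℝ) :
    weilIncrement g (c * t) = c * weilIncrement (fun x ↦ g (c * x)) t := by
  unfold weilIncrement
  have e : (fun x : ℝ ↦ ‖g (c * (x + t)) - g (c * x)‖ ^ 2) =
      fun x ↦ (fun y : ℝ ↦ ‖g (y + c * t) - g y‖ ^ 2) (c * x) := by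
    funext x
    simp only [mul_add]
  rw [e, Measure.integral_comp_mul_left (fun y : ℝ ↦ ‖g (y + c * t) - g y‖ ^ 2) c, smul_eq_mul,
    abs_of_pos (inv_pos.2 hc), ← mul_assoc, mul_inv_cancel₀ hc.ne', one_mul]

/-- **The substituted integrand is the energy density of the rescaling**: for `c > 0`,
`(w((ct)/c)/c) · D_{ct}(g) = w(t) · D_t(g(c ·))`. [folklore] -/
theorem dilationEnergy_integrand_mul_left (g : ℝ → ℂ) {c : ℝ} (hc : 0 < c) (t : ℝ) :
    weilArchDensity (c * t / c) / c * weilIncrement g (c * t) =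
      weilArchDensity t * weilIncrement (fun x ↦ g (c * x)) t := by
  rw [mul_div_cancel_left₀ t hc.ne', dilationEnergy_weilIncrement_mul_left g hc t]
  field_simp

/-- **Finite energy of the rescaled kernel**: for a test function `g` and `c > 0`,
`u ↦ (w(u/c)/c) · D_u(g)` is integrable on `(0, ∞)` (it is the substitution `u = ct` of the
energy density `w(t) D_t(g(c ·))` of the rescaled test function). [folklore] -/
theorem dilationEnergy_integrableOn_Ioi {g : ℝ → ℂ} (hg : IsWeilTest g)
    {c : ℝ} (hc : 0 < c) :
    IntegrableOn (fun u : ℝ ↦ weilArchDensity (u / c) / c * weilIncrement g u) (Ioi 0) := by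
  have h := integrableOn_weilArchDensity_mul_weilIncrement (hg.comp_mul hc.ne')
  have e : (fun t : ℝ ↦ weilArchDensity t * weilIncrement (fun x ↦ g (c * x)) t) =
      fun t ↦ (fun u : ℝ ↦ weilArchDensity (u / c) / c * weilIncrement g u) (c * t) := by
    funext t
    exact (dilationEnergy_integrand_mul_left g hc t).symm
  rw [e] at h
  have h' := (integrableOn_Ioi_comp_mul_left_iff
    (fun u : ℝ ↦ weilArchDensity (u / c) / c * weilIncrement g u) 0 hc).1 h
  rwa [mul_zero] at h'

/-- **The substitution `u = ct`**: for `c > 0`,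
`∫₀^∞ w(t) D_{ct}(g) dt = ∫₀^∞ (w(u/c)/c) D_u(g) du`. [folklore] -/
theorem dilationEnergy_setIntegral_Ioi_eq (g : ℝ → ℂ) {c : ℝ} (hc : 0 < c) :
    ∫ t in Ioi (0 : ℝ), weilArchDensity t * weilIncrement g (c * t) =
      ∫ u in Ioi (0 : ℝ), weilArchDensity (u / c) / c * weilIncrement g u := by
  have h := integral_comp_mul_left_Ioi
    (fun u : ℝ ↦ weilArchDensity (u / c) / c * weilIncrement g u) 0 hc
  rw [mul_zero, smul_eq_mul] at h
  have h2 : ∫ t in Ioi (0 : ℝ), weilArchDensity t * weilIncrement g (c * t) =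
      c * ∫ t in Ioi (0 : ℝ), weilArchDensity (c * t / c) / c * weilIncrement g (c * t) := by
    rw [← integral_const_mul]
    refine setIntegral_congr_fun measurableSet_Ioi fun t _ ↦ ?_
    rw [dilationEnergy_integrand_mul_left g hc t, dilationEnergy_weilIncrement_mul_left g hc t]
    ring
  rw [h2, h, ← mul_assoc, mul_inv_cancel₀ hc.ne', one_mul]

/-- **The rescaled tail of the kernel**: for `c > 0`, `∫_{2R}^∞ w(u/c)/c du = ∫_{2R/c}^∞ w(t) dt`
(an identity of Bochner integrals, junk values included). [folklore] -/
theorem dilationEnergy_setIntegral_Ioi_weilArchDensity_div (R : ℝ) {c : ℝ} (hc : 0 < c) :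
    ∫ u in Ioi (2 * R), weilArchDensity (u / c) / c = ∫ t in Ioi (2 * R / c), weilArchDensity t := by
  have h := integral_comp_mul_left_Ioi (fun v : ℝ ↦ weilArchDensity v / c) (2 * R) (inv_pos.2 hc)
  simp only [inv_inv, smul_eq_mul] at h
  rw [MeasureTheory.integral_div c weilArchDensity, mul_div_cancel₀ _ hc.ne', inv_mul_eq_div] at h
  rw [← h]
  refine setIntegral_congr_fun measurableSet_Ioi fun u _ ↦ ?_
  rw [inv_mul_eq_div]

/-- **Stub T2 — dilation identity for the archimedean energy.** For a test function `g` supported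
in `[-R, R]` and a compression factor `c > 0`: substituting `u = c t` and using `D_u(g) = 2‖g‖₂²`
for `u > 2R`,
`∫₀^∞ w(t) D_{ct}(g) dt = ∫_{(0,2R]} (w(u/c)/c) D_u(g) du + 2‖g‖₂² ∫_{2R/c}^∞ w(t) dt`
(and the finite-part integrand is integrable). [folklore] -/
theorem stub_dilationEnergy :
    ∀ (g : ℝ → ℂ) (R c : ℝ), Literature.NumberTheory.LFunctions.IsWeilTest g →
      tsupport g ⊆ Set.Icc (-R) R → 0 < R → 0 < c →
      MeasureTheory.IntegrableOn
          (fun u : ℝ ↦ Literature.NumberTheory.LFunctions.weilArchDensity (u / c) / c *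
            Literature.NumberTheory.LFunctions.weilIncrement g u) (Set.Ioc 0 (2 * R)) ∧
        ∫ t in Set.Ioi (0 : ℝ), Literature.NumberTheory.LFunctions.weilArchDensity t *
            Literature.NumberTheory.LFunctions.weilIncrement g (c * t) =
          (∫ u in Set.Ioc (0 : ℝ) (2 * R), Literature.NumberTheory.LFunctions.weilArchDensity (u / c) / c *
              Literature.NumberTheory.LFunctions.weilIncrement g u) +
            2 * (∫ x : ℝ, ‖g x‖ ^ 2) *
              ∫ t in Set.Ioi (2 * R / c), Literature.NumberTheory.LFunctions.weilArchDensity t := by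
  intro g R c hg hgR hR hc
  have hgs : ∀ x, x ∉ Icc (-R) R → g x = 0 := fun x hx ↦
    image_eq_zero_of_notMem_tsupport fun h ↦ hx (hgR h)
  have hint := dilationEnergy_integrableOn_Ioi hg hc
  have hIoc : IntegrableOn (fun u : ℝ ↦ weilArchDensity (u / c) / c * weilIncrement g u)
      (Ioc 0 (2 * R)) := hint.mono_set Ioc_subset_Ioi_self
  have hIoi : IntegrableOn (fun u : ℝ ↦ weilArchDensity (u / c) / c * weilIncrement g u)
      (Ioi (2 * R)) := hint.mono_set (Ioi_subset_Ioi (by linarith))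
  refine ⟨hIoc, ?_⟩
  rw [dilationEnergy_setIntegral_Ioi_eq g hc,
    ← Ioc_union_Ioi_eq_Ioi (by linarith : (0 : ℝ) ≤ 2 * R),
    setIntegral_union (Ioc_disjoint_Ioi le_rfl) measurableSet_Ioi hIoc hIoi]
  congr 1
  -- the tail: `D_u(g) = 2‖g‖₂²` on `Ioi (2R)`, then substitute back
  have htail : ∫ u in Ioi (2 * R), weilArchDensity (u / c) / c * weilIncrement g u =
      ∫ u in Ioi (2 * R), (2 * ∫ x : ℝ, ‖g x‖ ^ 2) * (weilArchDensity (u / c) / c) := by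
    refine setIntegral_congr_fun measurableSet_Ioi fun u hu ↦ ?_
    rw [dilationEnergy_weilIncrement_eq_two_mul hg.memLp_two hgs (le_of_lt hu)]
    ring
  rw [htail, integral_const_mul, dilationEnergy_setIntegral_Ioi_weilArchDensity_div R hc]

end Summit.RiemannHypothesis.RiemannHypothesis.Theorems.WeilParity.EvenWinsArch
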